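import Literature.Combinatorics.SimpleGraph.PRankLeRank
import HarnessLib

/-!
# Spanning mod `p` implies spanning in characteristic zero (span form of `rk_p(M) ≤ rk(M)`)

Topic `Literature/LinearAlgebra/Matrix`; a trunk-independent tool (0 named facts, everything
PROVED). The rank form of the statement — for an integral matrix `M` and a prime `p`,
`rk_p(M) ≤ rk(M)`, and more generally `rk_F(φ M) ≤ rk_K(ι M)` for any ring map `φ : R →+* F` into a
field and any injective ring map `ι : R →+* K` into a field — is already a theorem of the tree:
`Literature.Combinatorics.SimpleGraph.PRankLeRank.rank_map_le_rank_map` /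
`rank_map_zmod_le_rank` [cite: BrouwerHaemers2012, §13.3 Proposition 13.3.1]. This file only
records the SPAN-FORM corollaries that a computational spanning certificate consumes:

* `span_rows_map_eq_top_of_span_rows_map_eq_top` — if the rows of `φ M` span `Fⁿ` then the rows
  of `ι M` span `Kⁿ` (a full row span is rank `= n`, and `n = rk_F(φ M) ≤ rk_K(ι M) ≤ n`);
* `span_range_intCast_eq_top_of_span_range_intCast_eq_top` — an ARBITRARY family of integer
  vectors `v i : n → ℤ` whose reductions span `Fⁿ` over some field `F` (any characteristic, e.g.
  `F = ZMod p`) spans `Kⁿ` over every field `K` of characteristic zero (reduce to a finite linearly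
  independent spanning subfamily over `F`, then the matrix form);
  `span_range_intCast_eq_top_of_zmod` — the same with `F = ZMod p` named;
  `span_image_intCast_eq_top_of_span_image_intCast_eq_top` — the same for a SET of integer
  vectors (e.g. the `ℤ`-lattice generated by finitely many words applied to seed vectors: "the
  mod-`p` closure is the reduction of the `ℤ`-lattice generated by the same words, so its
  `𝔽_p`-dimension is at most the lattice rank");
* `span_range_basis_sum_eq_top_of_span_range_intCast_eq_top` — transported through a basis
  `B : Module.Basis n K V` of a `K`-vector space: the vectors `∑ j, (v i j : K) • B j` with the given
  integer coordinates span `V`.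

The converse fails (`rk_p` may drop: `PRankLeRank.rank_map_zmod_lt_rank_map_intCast`). [folklore]
-/

namespace Literature.LinearAlgebra.Matrix

open _root_.Matrix Module Literature.Combinatorics.SimpleGraph.PRankLeRank

universe u

variable {R K F : Type*} [CommRing R] [Field K] [Field F]
variable {m n : Type*} [Fintype m] [Fintype n]

/-- **Span form of `rk_F(φ M) ≤ rk_K(ι M)`.** Let `ι : R →+* K` be an injective ring map into a
field and `φ : R →+* F` any ring map into a field. If the rows of `φ M` span `F^n`, then the rows
of `ι M` span `K^n`: a full row span means rank `|n|`, and
`|n| = rk_F(φ M) ≤ rk_K(ι M) ≤ |n|` by `PRankLeRank.rank_map_le_rank_map`.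
[cite: BrouwerHaemers2012, §13.3 Proposition 13.3.1 (corollary: span form of the rank inequality)] -/
theorem span_rows_map_eq_top_of_span_rows_map_eq_top (ι : R →+* K) (hι : Function.Injective ι)
    (φ : R →+* F) (M : Matrix m n R)
    (h : Submodule.span F (Set.range (M.map φ).row) = ⊤) :
    Submodule.span K (Set.range (M.map ι).row) = ⊤ := by
  apply Submodule.eq_top_of_finrank_eq
  rw [finrank_fintype_fun_eq_card, ← rank_eq_finrank_span_row]
  refine le_antisymm (rank_le_card_width _) ?_
  calc Fintype.card n = finrank F (n → F) := (finrank_fintype_fun_eq_card _).symm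
    _ = finrank F (Submodule.span F (Set.range (M.map φ).row)) := by rw [h, finrank_top]
    _ = (M.map φ).rank := (rank_eq_finrank_span_row _).symm
    _ ≤ (M.map ι).rank := rank_map_le_rank_map ι hι φ M

/-- Integral matrices: if the rows of `M` reduced into ANY field `F` (e.g. `F = ZMod p`) span
`F^n`, then the rows of `M` span `K^n` over every field `K` of characteristic zero.
[cite: BrouwerHaemers2012, §13.3 Proposition 13.3.1 (corollary: span form of the rank inequality)] -/
theorem span_rows_intCast_eq_top_of_span_rows_intCast_eq_top [CharZero K] (M : Matrix m n ℤ)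
    (h : Submodule.span F (Set.range (M.map (Int.castRingHom F)).row) = ⊤) :
    Submodule.span K (Set.range (M.map (Int.castRingHom K)).row) = ⊤ :=
  span_rows_map_eq_top_of_span_rows_map_eq_top (Int.castRingHom K) Int.cast_injective
    (Int.castRingHom F) M h

/-- Finite families of integer vectors (the matrix statement, rows as a family). [folklore] -/
private theorem span_range_intCast_eq_top_of_fintype [CharZero K] {κ : Type*} [Fintype κ]
    (w : κ → n → ℤ) (h : Submodule.span F (Set.range fun k j ↦ (w k j : F)) = ⊤) :
    Submodule.span K (Set.range fun k j ↦ (w k j : K)) = ⊤ :=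
  span_rows_intCast_eq_top_of_span_rows_intCast_eq_top (K := K) (F := F) (Matrix.of w) h

/-- **Integer vectors that span mod `p` span in characteristic zero.** Let `v i : n → ℤ`
(`i : ι`, any index set) be integer vectors whose reductions into some field `F` (any
characteristic; `F = ZMod p` is `span_range_intCast_eq_top_of_zmod`) span `F^n`. Then they span
`K^n` over every field `K` of characteristic zero (`ℚ`, `ℝ`, `ℂ`). Proof: over `F` some finite
linearly independent subfamily already spans (`exists_linearIndependent'`,
`LinearIndependent.finite_of_isNoetherian`); apply the matrix form to it.
[cite: BrouwerHaemers2012, §13.3 Proposition 13.3.1 (corollary: span form of the rank inequality)] -/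
theorem span_range_intCast_eq_top_of_span_range_intCast_eq_top [CharZero K] {ι : Type u}
    (v : ι → n → ℤ) (h : Submodule.span F (Set.range fun i j ↦ (v i j : F)) = ⊤) :
    Submodule.span K (Set.range fun i j ↦ (v i j : K)) = ⊤ := by
  obtain ⟨κ, a, -, hspan, hli⟩ := exists_linearIndependent' F (fun i j ↦ (v i j : F))
  haveI : Finite κ := hli.finite_of_isNoetherian
  cases nonempty_fintype κ
  have hF : Submodule.span F (Set.range fun k j ↦ (v (a k) j : F)) = ⊤ := by
    rw [← h, ← hspan]
    rfl
  have hK := span_range_intCast_eq_top_of_fintype (K := K) (F := F) (fun k ↦ v (a k)) hF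
  refine eq_top_iff.2 (hK.ge.trans (Submodule.span_mono ?_))
  rintro _ ⟨k, rfl⟩
  exact ⟨a k, rfl⟩

/-- `F = ZMod p` named: integer vectors spanning `(ZMod p)^n` after reduction mod a prime `p`
span `K^n` over every field `K` of characteristic zero.
[cite: BrouwerHaemers2012, §13.3 Proposition 13.3.1 (corollary: span form of `rk_p(M) ≤ rk(M)`)] -/
theorem span_range_intCast_eq_top_of_zmod [CharZero K] (p : ℕ) [Fact p.Prime] {ι : Type u}
    (v : ι → n → ℤ)
    (h : Submodule.span (ZMod p) (Set.range fun i j ↦ (v i j : ZMod p)) = ⊤) :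
    Submodule.span K (Set.range fun i j ↦ (v i j : K)) = ⊤ :=
  span_range_intCast_eq_top_of_span_range_intCast_eq_top (F := ZMod p) v h

/-- Set form (e.g. `S` = the `ℤ`-lattice generated by finitely many words applied to seed
vectors): if the reductions into a field `F` of a set `S` of integer vectors span `F^n`, then `S`
spans `K^n` over every field `K` of characteristic zero.
[cite: BrouwerHaemers2012, §13.3 Proposition 13.3.1 (corollary: span form of the rank inequality)] -/
theorem span_image_intCast_eq_top_of_span_image_intCast_eq_top [CharZero K] (S : Set (n → ℤ))
    (h : Submodule.span F ((fun x j ↦ (x j : F)) '' S) = ⊤) :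
    Submodule.span K ((fun x j ↦ (x j : K)) '' S) = ⊤ := by
  rw [Set.image_eq_range] at h ⊢
  exact span_range_intCast_eq_top_of_span_range_intCast_eq_top (F := F) (fun x : S ↦ (x : n → ℤ)) h

/-- Through a basis. Let `B` be a basis of a `K`-vector space `V` (`K` of characteristic zero)
indexed by `n`, and `v i : n → ℤ` integer coordinate vectors whose reductions into a field `F`
span `F^n`. Then the vectors `∑ j, (v i j : K) • B j` span `V`.
[cite: BrouwerHaemers2012, §13.3 Proposition 13.3.1 (corollary: span form of the rank inequality)] -/
theorem span_range_basis_sum_eq_top_of_span_range_intCast_eq_top [CharZero K] {V : Type*}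
    [AddCommGroup V] [Module K V] (B : Basis n K V) {ι : Type u} (v : ι → n → ℤ)
    (h : Submodule.span F (Set.range fun i j ↦ (v i j : F)) = ⊤) :
    Submodule.span K (Set.range fun i ↦ ∑ j, (v i j : K) • B j) = ⊤ := by
  have hK := span_range_intCast_eq_top_of_span_range_intCast_eq_top (K := K) (F := F) v h
  have himg : (Set.range fun i ↦ ∑ j, (v i j : K) • B j) =
      (B.equivFun.symm : (n → K) →ₗ[K] V) '' Set.range (fun i j ↦ (v i j : K)) := by
    rw [← Set.range_comp]
    congr 1
    funext i
    simp [Basis.equivFun_symm_apply]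
  rw [himg, ← Submodule.map_span, hK, Submodule.map_top, LinearEquiv.range]

end Literature.LinearAlgebra.Matrix
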